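import Mathlib

/-!
# K2OctetCount — kernel plate for the ARITHMETIC half of THEOREM K2 (c) of memo
`R2-12-E6-QUOTIENT-OBJECT-semihom1-g49.md` (hsemireg-semihom-1 g49, READING-2 owner; PEN + typing only)

Token: line stmt-HodgeConjecture-18881 Cruxes/BlochSeedDiscOne/Lines/birth.lean 814a6a70c14e831a stub_rung_pad4_seedAt.
HC ∕ HC_CM ∕ HC_AV ∕ №4 ∕ 26512 ∕ 18881 ∕ 30548 ∕ H2 are NOT proved or touched here; width toward H2 = 0.
Nothing below is a statement about sheaves on an abelian fourfold.  The GEOMETRIC INPUT is pen (memo §3):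
for a rank-2 `G`-sheaf `F` of class `2α₁` (`χ(F,F) = 32`, `rank μ = 12`) on a ppav₄ `X`, locally free at the
`256·N` reflection-fixed points, `G = ⟨G₀, ρ⟩` with `G₀ ⊂ X × X̂` finite of order `N = N₁·N₂`
(`N₂ = |pr₂ G₀|` twist components — a subgroup of `X̂[2]`, so `N₂ ∣ 256` — and `N₁ = |G₀ ∩ X|`), the Kummer
count reads `e₂^G − 2 e₁^G = (32 + Σ_ρ L(ρ))/(2N) − 2` with `Σ_ρ L(ρ) = 32 (N − c) + 64 c_s`, where `c ∈ {0, N₁}`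
is the number of constant-type reflections and `c_s ∈ {0, c/2, c}` the number of scalar-type ones.  Hence
`(B1) ∧ SR` (i.e. `e₁^G = 0 ∧ e₂^G = 12`) is the Diophantine condition `N + 8 = 8 c − 16 c_s`, and `SR` alone in
the untwisted case (`N₂ = 1`, `c = N`, `c_s = m'`) is `N·e₁ + 8 + 16 m' = 7 N`.
What is kernel-checked here (Mathlib only; no `sorry`, no instances, no notation, no unsafe options):
* `octet_unique`  : the only admissible solution of `(B1) ∧ SR` is `(N₁, N₂, c, c_s) = (2, 4, 2, 0)` — the OCTET `N = 8`;
* `untwisted_none`: with `N₂ = 1` (pure translation groups `G₀ ⊂ X`, e.g. every Kummer ∕ translation-Kummer group) there is NO solution;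
* `sr_untwisted`  : `SR` alone with `N₂ = 1` forces `m' = 0` and `(N, e₁^G) ∈ {(2,3), (4,5), (8,6)}` — never `e₁^G = 0`;
* `no_power_hyp_needed_counterexamples`: without `N₂ ∣ 256` the equation has the spurious solutions `(4,6)` and `(8,7)`,
  so the 2-torsion hypothesis on the twist components is load-bearing.
-/

namespace H21Scratch.K2OctetCount

/-- `(B1) ∧ SR` for the Kummer count: `N₁ N₂ + 8 + 16 c_s = 8 c`. -/
def B1SR (N1 N2 c cs : ℕ) : Prop := N1 * N2 + 8 + 16 * cs = 8 * c

/-- Admissible parameters: `N₁, N₂ ≥ 1`, `N₂ ∣ 256` (twist part a subgroup of `X̂[2] ≅ (ℤ/2)⁸`),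
`c ∈ {0, N₁}`, `c_s ∈ {0, c/2, c}`. -/
def Admissible (N1 N2 c cs : ℕ) : Prop :=
  1 ≤ N1 ∧ 1 ≤ N2 ∧ N2 ∣ 256 ∧ (c = 0 ∨ c = N1) ∧ (cs = 0 ∨ 2 * cs = c ∨ cs = c)

theorem octet_unique (N1 N2 c cs : ℕ) (hA : Admissible N1 N2 c cs) (h : B1SR N1 N2 c cs) :
    N1 = 2 ∧ N2 = 4 ∧ c = 2 ∧ cs = 0 := by
  unfold Admissible B1SR at *
  obtain ⟨h1, h2, hdvd, hc, hcs⟩ := hA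
  -- `N₂ ≤ 7`: otherwise `N₁ N₂ ≥ 8 N₁ ≥ 8 c`, contradicting `N₁ N₂ + 8 + 16 c_s = 8 c`.
  have hN2 : N2 ≤ 7 := by
    rcases le_or_gt N2 7 with h' | h'
    · exact h'
    · have h8 : N1 * 8 ≤ N1 * N2 := Nat.mul_le_mul_left N1 (by omega)
      rcases hc with rfl | rfl <;> omega
  interval_cases N2 <;> rcases hc with rfl | rfl <;> rcases hcs with rfl | hh | rfl <;> omega

theorem untwisted_none (N1 c cs : ℕ) (hA : Admissible N1 1 c cs) : ¬ B1SR N1 1 c cs := by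
  intro h
  have := octet_unique N1 1 c cs hA h
  omega

/-- The bare equation `N₁ (8 − N₂) = 8 + 16 c_s` without `N₂ ∣ 256` has spurious solutions. -/
theorem no_power_hyp_needed_counterexamples :
    B1SR 4 6 4 0 ∧ B1SR 8 7 8 0 ∧ B1SR 2 4 2 0 := by
  unfold B1SR; decide

/-- `SR` alone, untwisted case: `N e₁ + 8 + 16 m' = 7 N` with `m' ∈ {0, N/2, N}`. -/
theorem sr_untwisted (N e1 m : ℕ) (hN : 1 ≤ N) (hm : m = 0 ∨ 2 * m = N ∨ m = N)
    (h : N * e1 + 8 + 16 * m = 7 * N) :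
    m = 0 ∧ (N = 2 ∧ e1 = 3 ∨ N = 4 ∧ e1 = 5 ∨ N = 8 ∧ e1 = 6) := by
  have he : e1 ≤ 6 := by
    rcases le_or_gt e1 6 with h' | h'
    · exact h'
    · have h7 : N * 7 ≤ N * e1 := Nat.mul_le_mul_left N (by omega)
      omega
  interval_cases e1 <;> rcases hm with rfl | hh | rfl <;> omega

/-- In particular `SR` never comes with `(B1)` (`e₁ = 0`) in the untwisted case. -/
theorem sr_untwisted_not_B1 (N m : ℕ) (hN : 1 ≤ N) (hm : m = 0 ∨ 2 * m = N ∨ m = N) :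
    ¬ (N * 0 + 8 + 16 * m = 7 * N) := by
  intro h
  have := sr_untwisted N 0 m hN hm h
  omega

/-- The memo's table value: for `F_{A,Z}` on the `τ_x`-stable stratum with `G = ⟨ρ_a, τ_x⟩` (`N = 2`),
`L(ρ_a) = 32`, `L(σ) = 0`: `e₂ − 2 e₁ = (32 + 32 + 0)/(2·2) − 2 = 14 > 12`. -/
theorem faz_table_min : (32 + 32 + 0) / (2 * 2) - 2 = (14 : ℕ) ∧ (12 : ℕ) < 14 := by decide

end H21Scratch.K2OctetCount
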